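import Mathlib
import HarnessLib
import Literature.NumberTheory.GelbartRogawski1991.WeilRepresentationsAPackets
import Literature.NumberTheory.GelbartRogawski1991.Sec1Defs
import Literature.NumberTheory.GelbartRogawski1991.Sec5Defs

/-!
# Gelbart–Rogawski 1991, §6 «Fourier-Jacobi coefficients of endoscopic forms» (pp. 468–471):
# THEOREM 6.1.1, the Remark (p. 469), PROPOSITION 6.2.1, LEMMA 6.2.2 and the local Howe-lift
# computations of pp. 470–471 — AS A TYPED DICTIONARY over ★ `GR91Spectrum`, ★ `EndoscopicLData`
# (`Sec1Defs`) and ★ `ThetaLiftData` (`Sec5Defs`)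

Reproduction (typed skeleton, DICTIONARY LEVEL — transcription discipline of
★ `Literature/NumberTheory/GelbartRogawski1991/WeilRepresentationsAPackets.lean`) of §6 of S. Gelbart,
J. Rogawski, *L-functions and Fourier–Jacobi coefficients for the unitary group `U(3)`*, Invent. Math.
**105** (1991) 445–472 [GelbartRogawski1991].  Every quotation «…» was read on the page IMAGES of the
printed article (GDZ Göttingen digitisation PPN356556735_0105, printed pp. 466–471; "p. N Lk" = printed
page, k-th body line, a display counted as one line); `[sic]` marks misprints.  Carpet-typing squad TG
(cell `hodgecm-mathlib`, seat TG-t04), section §6 of the squad FILE MAP; namespace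
`Literature.NumberTheory.GelbartRogawski1991.Sec6`.  The squad's SHARED CARRIERS are imported, not
re-posited (squad RULING 2): the spectrum ★ `GR91Spectrum` (`X`), the `L`-function / packet carrier
★ `Sec1Defs.EndoscopicLData` (`D`: `IsCuspidal`, `PacketU2`, `IsCuspidalU2`, `twistDetU2`, `packetL` =
`Π(ϱ)`, `locPacketL` = `Π(ϱ_v)`, `loc v` = the ★ local dictionary at `v` with `comp π v = π_v`, `ofOmega`,
`bc1` = `ν ↦ ν_E`, `LHecke` = `L_E(s, χ)`, `Place`) and the theta-lifting carrier
★ `Sec5Defs.ThetaLiftData` (`T`: unitary groups `H′ = U(Φ′)` (`UGrp`, `dim`), their cuspidal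
representations `CuspRep`, theta data `ThetaDatum` = `(s, ψ)`, `IsThetaLift` = «`π` is a theta-series
lifting of `τ`», `OccursU1` = «`χ` occurs in `ω¹(γ, ψ)`», `NormClass` = `F*/N_{E/F}(E*)` with
`twistAdd` = `ψ ↦ ψ_δ`).  NOTHING IS ASSERTED: every printed statement is a predicate
`def … (D …) (T …) : Prop` / `def … (S : Sec6Data X D T) : Prop`; a consumer supplies the dictionaries from its own model and takes
`(h : S.thm611)` as an explicit hypothesis (`HeckeE`, `HeckeF` = the Hecke-character groups of `E` and `F`
binding `D`).  HONEST LABEL: nothing here proves anything about `U(3)`;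
HC_CM is proved only modulo its printed citations until rung 0 closes.

GENERALITY (§1.1, p. 449): `E/F` a quadratic extension of number fields, `G` = the QUASI-SPLIT `U(3)`;
`H = U(2) × U(1)`, the embedding `ξ_H : ᴸH → ᴸG` fixed by `μ` (§1.4, p. 450); `Π(ϱ)` «the L-packet on
`G` corresponding to `ϱ` with respect to `ξ_H`» for an L-packet `ϱ = ϱ₂ × ϱ₁` on `H`, `dim(ϱ) ≠ 1`
(§1.4, p. 450).  §6.1 (p. 468 L11): «In this section, let `ϱ = ϱ₂ × ϱ₁` be a cuspidal L-packet on `H`.»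
— typed throughout as `ϱ₂ : D.PacketU2` with `D.IsCuspidalU2 ϱ₂` and `ϱ₁ : X.Char1`.

## Source text (pp. 466–471, verbatim)

[§5.2, p. 466 L37 – p. 467 L3] «We recall the notion of theta-series lifting. Suppose that `G` and
`H` are unitary groups in `n` and `m` variables, respectively. Then there exists an embedding `s` of
`G × H` in the metaplectic group on `2nm` variables … Let `π` and `τ` be irreducible cuspidal
representations of `G` and `H`, respectively. We say that `π` is a theta-series lifting of `τ` if `V_τ`
[sic: `V_π`] is contained in the space `Θ(ψ, s, τ)` of functions of the form
`g ⟶ ∫_{H(F)\H(𝐀)} ϑ(g, h) f(h) dh` for some `ϑ(g, h)` and some `f ∈ V_τ`.»  [p. 467 L31–35] «In the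
context of `(U(1), U(1))`, the Howe lift of `χ` relative to `ω¹(γ, ψ)` is defined only if `χ` occurs in
`ω¹(γ, ψ)`, in which case the Howe lift is `χ` itself.»

**THEOREM 6.1.1** (p. 468 L12–17). «Assume that `π ∈ Π(ϱ)` is cuspidal. Let `τ = τ(γ, ψ, χ)` and
suppose that `φ_τ ≠ 0` for some `φ ∈ V_π`. Then (1) `L(½, γ(ϱ_{1E})⁻¹ ≠ 0` [sic: `L(½, γ(ϱ_{1E})⁻¹) ≠ 0`].
(2) `π` is a theta-series lifting of a cuspidal representation on a unitary group `U(Φ′)` in two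
variables. The Hermitian form `Φ′` belongs to the class of `diag(−1, δ)`, where `δ` belongs to the
unique class in `F*/N_{E/F}(E*))` [sic] such that `ϱ₁` occurs in `ω¹(γ, ψ_δ)`.»  Printed proof inputs
(p. 468 L18 – p. 469 L6): «It follows from the definition of the embedding `ξ_H` that
`L_S(s + ½, π ⊗ ξ) = L_S(s + ½, ϱ_{2E} ⊗ μξ) L_S(s + ½, ϱ_{1E} ξ)`», non-vanishing at `s = ½` of the
first factor «([JS])» / «([R])», Theorem 4.3.1 and Proposition 4.3.2 (the Shimura integral
`SH(φ, θ, η, s)`, `η = γ(ϱ_{1E})⁻¹`), «the result quoted in §4.1» (pole of `E(g, η, s)` at `s = ½` ⇒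
`L(½, η) ≠ 0`), «the residue is a theta series belonging to `ω(η, η¹, ψ^δ)`, where `δ` belongs to the
unique coset in `F*/N_{E/F}(E*)` such that `η¹` occurs in `ω¹(η, ψ^δ)` (cf. remark of § 5.2)», a see-saw
with a theta series `ϑ(g, h)` on `G × U`, `U = U(Φ′)`, `Φ′ = diag(−1, δ)`, and «Using "multiplicity one"
for `G`» (= [R] Thm. 13.3.1, ★ `Literature.NumberTheory.Rogawski1990.QuasiSplitU3.thm1331`); footnote ¹
(p. 469): «That the theta-lift of `σ` back to `G` is again cuspidal follows from Theorem 13.3.2 of [R]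
plus a computation … pointed out to us by D. Soudry.»

**Remark** (p. 469 L7–10). «In general, one cannot expect that all cuspidal members `π` of `Π(ϱ)` will
be theta-series lifts from the quasi-split group `U(2)`. However, if `π` has a Whittaker model, then
`π` is in fact a theta-series lift from the quasi-split group `U(2)` ([GP₂]).»

[§6.2, p. 469 L11–12] «By the above theorem, every cuspidal element in `Π(ϱ)` is a theta-series lift
from some `U(Φ′)`. We now check that the converse holds.»
**PROPOSITION 6.2.1** (p. 469 L13–15). «Let `σ` be a cuspidal representation of `U(Φ′)`, and `s` a
splitting as above. Then all irreducible cuspidal subrepresentations `π` of `Θ(ψ, s, σ)` belong to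
`Π(ϱ)` for some `ϱ`.»  (p. 469 L16–18: «Together with Theorem 5.1.1, this shows that the set of
discrete endoscopic representations of `U(3)` coincides with the set of theta series lifts from
unitary groups `U(Φ′)` where `Φ′` is a Hermitian form in 1 or 2 variables.»)  *Proof* (p. 469
L19–21): «For almost all `v`, `π_v` is the Howe lift of `σ_v` and hence, by the strong multiplicity one
theorem for L-packets ([R]), it suffices to prove the following proposition.»
**LEMMA 6.2.2** (p. 469 L22–29). «Let `σ` be a cuspidal representation of `U(Φ′)`, where `Φ′` is a
Hermitian form in two variables. Then there exists a cuspidal representation `ϱ` such that for almost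
all `v`, the Howe lift of `σ_v` belongs to `Π(ϱ_v)`. More precisely, in the proof below, we define Hecke
characters `γ₂` of `E*` and `γ₃` of `E¹`, where the restriction of `γ₂` to `F*` is `ω_{E/F}`. Let `ξ`
be the character of `E¹` defined by the relation `μ⁻¹γ₂⁻¹(α) = ξ(α/ᾱ)`. Let `σ′` be the cuspidal
L-packet on `U(2)` corresponding to `σ` by the Jacquet- Langlands correspondence for two variable
unitary groups. Then `ϱ = ϱ₂ × ϱ₁` where `ϱ₂ = σ′ ⊗ (ξγ₃ ∘ det)` and `ϱ₁ = γ₃`.»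
Local computation (p. 469 L30 – p. 471 L6, at a place `v` that «remains prime»): «We recall that the
Howe correspondence is known for almost all `v`. … we need only calculate the Howe lift locally of
unramified representations from `U(2)` to `U(3)` (and `GL₂` to `GL₃` for the split places).»  (p. 470
L16–19) «`ω(diag(α, ᾱ⁻¹), 1)ϕ(w₋₁ ⊗ e₁) = γ₂(α) ‖α‖^{−3/2} ϕ(α⁻¹w₋₁ ⊗ e₁)` and
`ω(1, diag(α, β, ᾱ⁻¹))ϕ(w₋₁ ⊗ e₁) = γ₃((α/ᾱ)β)ϕ(α⁻¹w₋₁ ⊗ e₁)` where `γ₂ = γ` and `γ₃ = γ¹`. A different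
choice of `s` changes `γ₂` by a Hecke character of the form `χ(α/ᾱ)` and `γ₃` by a Hecke character of
`E¹`.»  (p. 470 L25–39) «Assume that `ν`, `γ₂`, and `γ₃` are unramified, and that the residual
characteristic of `v` is different from 2. (In this case, the Howe correspondence is known (cf. [Wd₂]).
Let `π_{U(2)}(νγ₂)` and `π_G(ν ⊗ γ₃ ∘ det)` denote the unramified constituents of `Ind_{U(2)}(νγ₂)` and
`Ind_G(ν ⊗ γ₃ ∘ det)`, respectively. … This shows that the Howe lift of `π_{U(2)}(νγ₂)` is
`π_G(ν ⊗ γ₃ ∘ det)`, or equivalently, the Howe lift of `π_{U(2)}(ν)` is `π_G(νγ₂⁻¹) ⊗ γ₃ ∘ det`.»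
(«`Ind_{U(2)}`» is «induced from the lower triangular Borel subgroup of `U(2)`» and «`Ind_G`» «from the
upper triangular Borel subgroup of `G`», p. 470 L21–23.)  (p. 471 L1–6) «the endoscopic transfer of the
representation `π_{U(2)}(ν) ⊗ χ` of `H = U(2) × U(1)` relative to the L-map `ᴸH → ᴸG` defined by `μ` is
`π_G(χ′)`, where `χ′(diag(α, β, α)) = νμ(α)χ(β)` [sic: `diag(α, β, ᾱ⁻¹)`]. … By the above computation,
the Howe lift of `σ_v` belongs to `Π(ϱ_v)` if `v` remains prime and `σ_v` is a principal series
representation.»  Split places (p. 471 L7–17): «identify `H` and `G` with `GL₂(F_v)` and `GL₃(F_v)` …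
the oscillator representation of `GL₂ × GL₃` on `𝒮(M_{2×3}(F))` defined by
`ω(h, g)ϕ(X) = |det(h)|^{3/2} |det(g)| ϕ(ᵗhXg)`. … `F(g, ϕ, v)` belongs to the space of the
representation `π` induced from `σ* ⊗ 1` on the lower (2,1)-parabolic subgroup `P` of `GL₃`. Here `σ*`
is the contragredient of `σ″`. It follows that `Ind_p(σ ⊗ 1)` [sic: `Ind_P(σ* ⊗ 1)`] is the Howe lift
of `σ″` (cf. [MVW]).»

## What is typed, and how

* `Sec6Data X D T` — the §6-ONLY sockets, ONE posited structure over the imported carriers (every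
  field's printed meaning quoted at the field): «`φ_τ ≠ 0` for some `φ ∈ V_π`, `τ = τ(γ, ψ, χ)`», «`Φ′`
  belongs to the class of `diag(−1, δ)`», «quasi-split `U(2)`», Whittaker models, «`π_v` is the Howe
  lift of `σ_v`», the Jacquet–Langlands packet `σ′`, and the characters `γ₂`, `γ₃` that Lemma 6.2.2
  attaches to `s` (its `ξ` is bound by the printed relation `XiRel`).  P items (verbatim statements as predicates) — over the shared carriers alone
  (§1 of the file): `cuspidal_isThetaLift` (p. 469 L11–12), `prop621` (UNIFORM form: the `ϱ` depends on `(σ, s)` only, as the printed proof via Lemma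
  6.2.2 gives), `strongMultOne_packetL` (the use of «[R]» on p. 469 L19–21 = [Rogawski1990] Thm.
  13.3.5, ★ `QuasiSplitU3.thm1335`); over `S : Sec6Data X D T` (§3–§4): `thm611_1`, `thm611_2` (and
  `thm611 := thm611_1 ∧ thm611_2`), `remark_whittaker`, `thetaLift_loc` (proof of 6.2.1, first clause),
  `HoweLiftsInto`, `XiRel`, `lemma622`.  NO theorems (squad RULING 3 (a): carpets are statements only);
  the pure-logic consequences are recorded as remarks: K1 Prop. 6.2.1 follows from `thetaLift_loc`,
  `lemma622` (first conjunct) and `strongMultOne_packetL` — the printed proof's architecture; K2 with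
  `cuspidal_isThetaLift`, a cuspidal `π` lies in some `Π(ϱ)` (`ϱ` cuspidal on `H`) iff it is a
  theta-series lifting from some `U(Φ′)` in two variables (the two-variable half of the gloss p. 469
  L16–18).
* `UnramifiedHoweLiftData` (LOCAL, one place `v` of `F` that remains prime in `E`; characters of `E_v*`
  and `E_v¹` are type PARAMETERS carrying Mathlib `CommGroup` structure — no instance is declared):
  P items `howeLift_unramified` (p. 470 L25–39) and `transfer_unramified` (p. 471 L1–3); the defined
  object `piGdet` records the printed identity `(γ₃ ∘ det)(diag(α, β, ᾱ⁻¹)) = γ₃((α/ᾱ)β)` (p. 470 L17).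
* `SplitHoweLiftData` (LOCAL, a split place): P item `howeLift_split` (p. 471 L13–17, «(cf. [MVW])»).

READING CHOICES (each repeated at its decl).  (i) «the unique class `δ` such that `ϱ₁` occurs in
`ω¹(γ, ψ_δ)`»: `thm611_2` asserts the EXISTENCE of such a class carrying the theta lifting (part of the
conclusion of 6.1.1 (2) as printed); the uniqueness the print presupposes is §5.2's (Cor. 5.2.2 «unique
modulo norms», the squad's `Sec5.cor522`) and is a docstring gloss, not re-asserted (squad RULING 3 (b)).  (ii) «irreducible cuspidal
subrepresentation `π` of `Θ(ψ, s, σ)`» = `D.IsCuspidal π ∧ Sec5Defs.IsThetaLift T H σ d π` (`IsThetaLift` is the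
printed DEFINITION `V_π ⊆ Θ(ψ, s, σ)` of ★ `Sec5Defs`).  (iii) «the Howe lift of `σ_v` belongs to
`Π(ϱ_v)`» (6.2.2) is typed as: a Howe lift of `σ_v` exists and every Howe lift of `σ_v` lies in
`Π(ϱ_v)` (`HoweLiftsInto`).  (iv) The relation «`μ⁻¹γ₂⁻¹(α) = ξ(α/ᾱ)`» defining `ξ` is typed in the
group `HeckeE` of Hecke characters of `E` of ★ `Sec1Defs` as `(ofOmega μ)⁻¹ (ofOmega γ₂)⁻¹ = bc1 ξ`
(`XiRel`; `bc1 ξ = ξ_E`, `ξ_E(α) = ξ(α/ᾱ)`, §1.2), and Lemma 6.2.2 is stated for every `ξ` satisfying it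
(the print presupposes that `ξ` exists and is unique) together with its first sentence («there exists a
cuspidal representation `ϱ` …») as a separate conjunct.  (v) `L(½, γ(ϱ_{1E})⁻¹)` is
`D.LHecke (D.ofOmega γ * (D.bc1 ϱ₁)⁻¹) (1/2)` (`ϱ_{1E} = bc1 ϱ₁`, §1.2).  (vi) «`U(Φ′)` in two variables»
= `T.dim H = 2`.  (vii) In `transfer_unramified` the characters `ν`, `μ_v`, `χ` are taken unramified (the
context of the printed computation, p. 470 L25) — the conservative reading.  (viii) `FJNonvanishing` is
a composite socket («`φ_τ ≠ 0` for some `φ ∈ V_π`», `τ = τ(γ, ψ, χ)`), i.e. `τ(γ, ψ, χ) ∈ Λ(π)` in the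
vocabulary of the squad's `Sec2Defs.GR91RData.Lambda` / `Sec3Theta` (not imported here: `τ(γ, ψ, χ)`,
p. 460–461, is typed there).

NOT typed here (other files of the squad / the tree): `τ(γ, ψ, χ) ∈ R^∧`, `φ_τ`, `Λ(π)` themselves
(§2, `Sec2Defs`/`Sec2`), the Shimura integral, `E(g, s, ξ)` and «the result quoted in §4.1» (§4, `Sec4`),
Prop. 5.2.1 / Cor. 5.2.2 / Remarks p. 468 (`Sec5`), Theorem 5.1.1 (★ `GR91Spectrum.thm511`), the
`L`-function factorisation for `Π(ϱ)` (§1.4, `Sec1`), the gloss p. 469 L16–18 (content = Thm. 5.1.1 +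
Thm. 6.1.1 (2) + Prop. 6.2.1; its two-variable half is the remark K2 above), the
functional `ℓ` and the Schrödinger-model computation p. 469 L30 – p. 470 L24, and any proof.

## References

* S. Gelbart, J. Rogawski, Invent. Math. 105 (1991) 445–472, doi 10.1007/BF01232276, §6 pp. 468–471
  (and §5.2 pp. 466–467 for the notion of theta-series lifting). [GelbartRogawski1991]
* J. Rogawski, *Automorphic representations of unitary groups in three variables*, Ann. of Math. Stud.
  123 (1990) (= [R]: Thms. 13.3.1, 13.3.2, 13.3.5). [Rogawski1990]
* As printed in the paper's reference list (pp. 471–472), not restated: [GP₂] Gelbart–Piatetski-Shapiro,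
  LNM 1041 (1984) 141–184; [JS] Jacquet–Shalika; [MVW] Moeglin–Vignéras–Waldspurger, LNM 1291; [Wd₂]
  Waldspurger; [H₂] Howe, Proc. Symp. Pure Math. 33; [Ra] Rallis.
-/

noncomputable section

namespace Literature.NumberTheory.GelbartRogawski1991.Sec6

open Filter

universe u

/-! ## §1 Statements of §6 that live over the shared carriers alone (`D`, `T`) -/

section SharedCarriers

variable {X : GR91Spectrum.{u}} {HeckeE HeckeF : Type u} [CommGroup HeckeE] [CommGroup HeckeF]

/-- **P (opening sentence of §6.2, printed as a consequence of Theorem 6.1.1)**: «By the above theorem,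
every cuspidal element in `Π(ϱ)` is a theta-series lift from some `U(Φ′)`.»  (`ϱ = ϱ₂ × ϱ₁` a cuspidal
L-packet on `H`, §6.1; `U(Φ′)` in two variables.  CAVEAT: not derivable here from `Sec6Data.thm611_2`,
whose hypothesis «`φ_τ ≠ 0` for some `φ`» (`Λ(π) ≠ ∅` for cuspidal `π`, §2.3) the sentence discharges
tacitly — do not cite this item as Theorem 6.1.1.) [cite: GelbartRogawski1991, §6.2 p. 469 L11–12] -/
def cuspidal_isThetaLift (D : Sec1Defs.EndoscopicLData X HeckeE HeckeF)
    (T : Sec5Defs.ThetaLiftData X) : Prop :=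
  ∀ (ϱ₂ : D.PacketU2) (ϱ₁ : X.Char1), D.IsCuspidalU2 ϱ₂ →
    ∀ π : X.Rep, π ∈ D.packetL ϱ₂ ϱ₁ → D.IsCuspidal π →
      ∃ H : T.UGrp, T.dim H = 2 ∧
        ∃ (σ : T.CuspRep H) (d : T.ThetaDatum H), Sec5Defs.IsThetaLift T H σ d π

/-- **P — PROPOSITION 6.2.1**: «Let `σ` be a cuspidal representation of `U(Φ′)`, and `s` a splitting as
above. Then all irreducible cuspidal subrepresentations `π` of `Θ(ψ, s, σ)` belong to `Π(ϱ)` for some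
`ϱ`.»  Typed in the UNIFORM form the printed proof establishes (the `ϱ` of Lemma 6.2.2 depends on
`(σ, s)` only, not on `π`): for every `U(Φ′)` in two variables (p. 469 L11–12 «from some `U(Φ′)`. We now
check that the converse holds»), cuspidal `σ` and data `d = (s, ψ)` there is a cuspidal L-packet
`ϱ = ϱ₂ × ϱ₁` on `H` (§6.1) with every irreducible cuspidal `π ⊆ Θ(ψ, s, σ)` (= `D.IsCuspidal π ∧
IsThetaLift T H σ d π`, the printed definition of ★ `Sec5Defs`) in `Π(ϱ)`; the pointwise reading («for some `ϱ`», one `π` at a time) follows by logic (K, not typed: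
squad RULING 3 (a) — carpets carry no theorems).  (The gloss p. 469 L16–18 «Together with Theorem 5.1.1, this shows that the
set of discrete endoscopic representations of `U(3)` coincides with the set of theta series lifts from
unitary groups `U(Φ′)` where `Φ′` is a Hermitian form in 1 or 2 variables» is not typed separately.)
[cite: GelbartRogawski1991, Proposition 6.2.1 (p. 469 L13–15)] -/
def prop621 (D : Sec1Defs.EndoscopicLData X HeckeE HeckeF) (T : Sec5Defs.ThetaLiftData X) :
    Prop :=
  ∀ (H : T.UGrp), T.dim H = 2 → ∀ (σ : T.CuspRep H) (d : T.ThetaDatum H),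
    ∃ (ϱ₂ : D.PacketU2) (ϱ₁ : X.Char1), D.IsCuspidalU2 ϱ₂ ∧
      ∀ π : X.Rep, D.IsCuspidal π → Sec5Defs.IsThetaLift T H σ d π → π ∈ D.packetL ϱ₂ ϱ₁

/-- **P (proof of Proposition 6.2.1, the use of «[R]»)**: «and hence, by the strong multiplicity one
theorem for L-packets ([R]), it suffices to prove the following proposition» — i.e. the inference the
printed proof draws from [R] (= [Rogawski1990] Thm. 13.3.5 «Let `Π, Π′ ∈ Π(G)`. If `Π_v = Π′_v` for
almost all `v`, then `Π = Π′`», ★ `Literature.NumberTheory.Rogawski1990.QuasiSplitU3.thm1335`): a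
cuspidal `π` whose local components `π_v = D.comp π v` lie in `Π(ϱ_v) = D.locPacketL v ϱ₂ ϱ₁` for almost
all `v` («almost all» = `Filter.cofinite` on `D.Place`) lies in `Π(ϱ)` (`ϱ` a cuspidal L-packet on
`H`).  Typed as that inference, not as Thm. 13.3.5 itself.
[cite: GelbartRogawski1991, proof of Proposition 6.2.1 (p. 469 L19–21)] -/
def strongMultOne_packetL (D : Sec1Defs.EndoscopicLData X HeckeE HeckeF) : Prop :=
  ∀ π : X.Rep, D.IsCuspidal π → ∀ (ϱ₂ : D.PacketU2) (ϱ₁ : X.Char1), D.IsCuspidalU2 ϱ₂ →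
    (∀ᶠ v in cofinite, D.comp π v ∈ D.locPacketL v ϱ₂ ϱ₁) → π ∈ D.packetL ϱ₂ ϱ₁

end SharedCarriers

/-! ## §2 The §6-only sockets -/

/-- **Posited primitives of §6** over ★ `GR91Spectrum` (`X`), the `L`-function / packet carrier
★ `Sec1Defs.EndoscopicLData` (`D`) and the theta-lifting carrier ★ `Sec5Defs.ThetaLiftData` (`T`).
Intended meaning of the fields:
* `FJNonvanishing π γ ψ χ` — «Let `τ = τ(γ, ψ, χ)` and suppose that `φ_τ ≠ 0` for some `φ ∈ V_π`»
  (p. 468 L12–13; `τ(γ, ψ, χ) ∈ R^∧`, p. 461 L1–3: «The choices `(s, ψ)` or `(γ, ψ)` mutually determine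
  each other and hence we can denote `τ(s, ψ, χ)` by `τ(γ, ψ, χ)`»; `φ_τ` the `τ`-component of the
  Fourier–Jacobi coefficient, §2.3; equivalently `τ(γ, ψ, χ) ∈ Λ(π)`, p. 452 L1–2);
* `InClassDiag H′ δ` — for `H′ = U(Φ′)`: «The Hermitian form `Φ′` belongs to the class of `diag(−1, δ)`»,
  `δ ∈ F*/N_{E/F}(E*)` (p. 468 L15–16);
* `IsQuasiSplit2 H′` — `H′` is «the quasi-split group `U(2)`» (Remark p. 469 L8–10);
* `HasWhittaker π` — «`π` has a Whittaker model» (p. 469 L9);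
* `IsHoweLiftAt σ d v π_v` — «`π_v` is the Howe lift of `σ_v`» (`π_v ∈ (D.loc v).LocRep`, an irreducible
  admissible representation of `G_v`) for the local theta correspondence of the pair `(U(Φ′)_v, G_v)`
  determined by `d = (s, ψ)` (p. 469 L19, L30: «the Howe correspondence is known for almost all `v`»);
* `jacquetLanglands σ` — «`σ′` … the cuspidal L-packet on `U(2)` corresponding to `σ` by the Jacquet-
  Langlands correspondence for two variable unitary groups» (p. 469 L27–28);
* `gamma2 d`, `gamma3 d` — «Hecke characters `γ₂` of `E*` and `γ₃` of `E¹`, where the restriction of `γ₂`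
  to `F*` is `ω_{E/F}`», attached to the splitting `s` of `d` (p. 469 L25–27; p. 470 L16–19: `γ₂ = γ`,
  `γ₃ = γ¹` for the `s` constructed there, «A different choice of `s` changes `γ₂` by a Hecke character
  of the form `χ(α/ᾱ)` and `γ₃` by a Hecke character of `E¹`»).
[cite: GelbartRogawski1991, §6 pp. 468–471] -/
structure Sec6Data (X : GR91Spectrum.{u}) {HeckeE HeckeF : Type u} [CommGroup HeckeE] [CommGroup HeckeF]
    (D : Sec1Defs.EndoscopicLData X HeckeE HeckeF) (T : Sec5Defs.ThetaLiftData X) :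
    Type u where
  /-- «`φ_τ ≠ 0` for some `φ ∈ V_π`», `τ = τ(γ, ψ, χ) ∈ R^∧` [p. 468 L12–13; p. 461 L1–3; p. 452 L1–2] -/
  FJNonvanishing : X.Rep → X.OmegaHecke → X.AddChar → X.Char1 → Prop
  /-- «`Φ′` belongs to the class of `diag(−1, δ)`» for `H′ = U(Φ′)` [p. 468 L15–16] -/
  InClassDiag : T.UGrp → T.NormClass → Prop
  /-- `H′` is the quasi-split `U(2)` [Remark p. 469 L8–10] -/
  IsQuasiSplit2 : T.UGrp → Prop
  /-- «`π` has a Whittaker model» [p. 469 L9] -/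
  HasWhittaker : X.Rep → Prop
  /-- «`π_v` is the Howe lift of `σ_v`» (local theta correspondence for `(U(Φ′)_v, G_v)` and `d`) [p. 469 L19, L24, L30] -/
  IsHoweLiftAt : {H : T.UGrp} → T.CuspRep H → T.ThetaDatum H → (v : D.Place) → (D.loc v).LocRep → Prop
  /-- `σ ↦ σ′`, the Jacquet–Langlands correspondent cuspidal L-packet on `U(2)` [p. 469 L27–28] -/
  jacquetLanglands : {H : T.UGrp} → T.CuspRep H → D.PacketU2
  /-- `γ₂`, Hecke character of `E*` with `γ₂|_{F*} = ω_{E/F}`, attached to `s` [p. 469 L25–27; p. 470 L16–19] -/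
  gamma2 : {H : T.UGrp} → T.ThetaDatum H → X.OmegaHecke
  /-- `γ₃`, Hecke character of `E¹`, attached to `s` [p. 469 L25–26; p. 470 L17–19] -/
  gamma3 : {H : T.UGrp} → T.ThetaDatum H → X.Char1

namespace Sec6Data

variable {X : GR91Spectrum.{u}} {HeckeE HeckeF : Type u} [CommGroup HeckeE] [CommGroup HeckeF]
  {D : Sec1Defs.EndoscopicLData X HeckeE HeckeF} {T : Sec5Defs.ThetaLiftData X}
  (S : Sec6Data X D T)

/-! ## §3 Theorem 6.1.1 and the Remark of p. 469 -/

/-- **P — THEOREM 6.1.1 (1)**: «Assume that `π ∈ Π(ϱ)` is cuspidal. Let `τ = τ(γ, ψ, χ)` and suppose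
that `φ_τ ≠ 0` for some `φ ∈ V_π`. Then (1) `L(½, γ(ϱ_{1E})⁻¹ ≠ 0` [sic: `L(½, γ(ϱ_{1E})⁻¹) ≠ 0`].»
(`ϱ = ϱ₂ × ϱ₁` a cuspidal L-packet on `H`, §6.1 p. 468 L11; `ϱ_{1E} = bc1 ϱ₁`, the base change of §1.2;
`L(½, ·) = LHecke · (1/2)` of ★ `Sec1Defs`.)
[cite: GelbartRogawski1991, Theorem 6.1.1 (1) (p. 468 L12–14)] -/
def thm611_1 : Prop :=
  ∀ (ϱ₂ : D.PacketU2) (ϱ₁ : X.Char1), D.IsCuspidalU2 ϱ₂ →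
    ∀ π : X.Rep, π ∈ D.packetL ϱ₂ ϱ₁ → D.IsCuspidal π →
      ∀ (γ : X.OmegaHecke) (ψ : X.AddChar) (χ : X.Char1), S.FJNonvanishing π γ ψ χ →
        D.LHecke (D.ofOmega γ * (D.bc1 ϱ₁)⁻¹) (1 / 2) ≠ 0

/-- **P — THEOREM 6.1.1 (2)**: «Assume that `π ∈ Π(ϱ)` is cuspidal. Let `τ = τ(γ, ψ, χ)` and suppose
that `φ_τ ≠ 0` for some `φ ∈ V_π`. Then … (2) `π` is a theta-series lifting of a cuspidal representation
on a unitary group `U(Φ′)` in two variables. The Hermitian form `Φ′` belongs to the class of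
`diag(−1, δ)`, where `δ` belongs to the unique class in `F*/N_{E/F}(E*))` [sic] such that `ϱ₁` occurs in
`ω¹(γ, ψ_δ)`.»  Typed: there is a class `δ ∈ F*/N_{E/F}(E*)` such that `ϱ₁` occurs in `ω¹(γ, ψ_δ)`,
a unitary group `H′ = U(Φ′)` in two variables with `Φ′` in the class of `diag(−1, δ)`, a cuspidal `σ` of
`U(Φ′)` and theta data `d = (s, ψ′)` with `π` a theta-series lifting of `σ` (the statement does not pin
`(s, ψ′)`; the printed proof, p. 468 L30 – p. 469 L6, produces them by a see-saw from the residue of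
`E(g, η, s)`).  GLOSS «the unique class»: the uniqueness of `δ` is not asserted here — it is §5.2's
(Cor. 5.2.2, p. 467: «When such a `ψ` exists, it is unique modulo norms», typed by the squad as
`Sec5.cor522`), so the printed definite description and this existential pick out the same class.
[cite: GelbartRogawski1991, Theorem 6.1.1 (2) (p. 468 L12–17)] -/
def thm611_2 : Prop :=
  ∀ (ϱ₂ : D.PacketU2) (ϱ₁ : X.Char1), D.IsCuspidalU2 ϱ₂ →
    ∀ π : X.Rep, π ∈ D.packetL ϱ₂ ϱ₁ → D.IsCuspidal π →
      ∀ (γ : X.OmegaHecke) (ψ : X.AddChar) (χ : X.Char1), S.FJNonvanishing π γ ψ χ →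
        ∃ δ : T.NormClass, T.OccursU1 γ (T.twistAdd δ ψ) ϱ₁ ∧
          ∃ H : T.UGrp, T.dim H = 2 ∧ S.InClassDiag H δ ∧
            ∃ (σ : T.CuspRep H) (d : T.ThetaDatum H), Sec5Defs.IsThetaLift T H σ d π

/-- **P — THEOREM 6.1.1** (both parts). [cite: GelbartRogawski1991, Theorem 6.1.1 (p. 468 L12–17)] -/
def thm611 : Prop :=
  S.thm611_1 ∧ S.thm611_2

/-- **P — Remark (citing [GP₂])**: «In general, one cannot expect that all cuspidal members `π` of
`Π(ϱ)` will be theta-series lifts from the quasi-split group `U(2)`. However, if `π` has a Whittaker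
model, then `π` is in fact a theta-series lift from the quasi-split group `U(2)` ([GP₂]).»  Typed: the
second sentence, for cuspidal members `π` of `Π(ϱ)` (the context of the first sentence); [GP₂] =
Gelbart–Piatetski-Shapiro, *Automorphic forms and L-functions for the unitary group*, LNM 1041 (1984)
141–184, as printed in the reference list p. 471. [cite: GelbartRogawski1991, Remark p. 469 L7–10] -/
def remark_whittaker : Prop :=
  ∀ (ϱ₂ : D.PacketU2) (ϱ₁ : X.Char1), D.IsCuspidalU2 ϱ₂ →
    ∀ π : X.Rep, π ∈ D.packetL ϱ₂ ϱ₁ → D.IsCuspidal π → S.HasWhittaker π →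
      ∃ H : T.UGrp, T.dim H = 2 ∧ S.IsQuasiSplit2 H ∧
        ∃ (σ : T.CuspRep H) (d : T.ThetaDatum H), Sec5Defs.IsThetaLift T H σ d π

/-! ## §4 §6.2: the printed proof architecture of Proposition 6.2.1 and Lemma 6.2.2 -/

/-- **P (proof of Proposition 6.2.1, first clause)**: «For almost all `v`, `π_v` is the Howe lift of
`σ_v`» — for an irreducible cuspidal subrepresentation `π` of `Θ(ψ, s, σ)`.  («almost all» =
`Filter.cofinite` on `D.Place`; `π_v = D.comp π v`.) [cite: GelbartRogawski1991, proof of Proposition 6.2.1 (p. 469 L19)] -/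
def thetaLift_loc : Prop :=
  ∀ (H : T.UGrp), T.dim H = 2 → ∀ (σ : T.CuspRep H) (d : T.ThetaDatum H) (π : X.Rep),
    D.IsCuspidal π → Sec5Defs.IsThetaLift T H σ d π →
      ∀ᶠ v in cofinite, S.IsHoweLiftAt σ d v (D.comp π v)

/-- «for almost all `v`, the Howe lift of `σ_v` belongs to `Π(ϱ_v)`» (`ϱ = ϱ₂ × ϱ₁`), read: for almost
all `v` a Howe lift of `σ_v` (for the data `d`) exists and every Howe lift of `σ_v` lies in `Π(ϱ_v)`.
[cite: GelbartRogawski1991, Lemma 6.2.2 (p. 469 L23–24)] -/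
def HoweLiftsInto {H : T.UGrp} (σ : T.CuspRep H) (d : T.ThetaDatum H) (ϱ₂ : D.PacketU2)
    (ϱ₁ : X.Char1) : Prop :=
  ∀ᶠ v in cofinite, (∃ πv : (D.loc v).LocRep, S.IsHoweLiftAt σ d v πv) ∧
    ∀ πv : (D.loc v).LocRep, S.IsHoweLiftAt σ d v πv → πv ∈ D.locPacketL v ϱ₂ ϱ₁

/-- «Let `ξ` be the character of `E¹` defined by the relation `μ⁻¹γ₂⁻¹(α) = ξ(α/ᾱ)`» — i.e.
`μ⁻¹γ₂⁻¹ = ξ_E` as Hecke characters of `E` (`γ₂ = gamma2 d` the character attached to the splitting `s` of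
`d`; both `μ` and `γ₂` restrict to `ω_{E/F}` on `I_F`, so `μ⁻¹γ₂⁻¹` is trivial on `I_F` and is a base
change `ξ_E`, §1.2), written in the group `HeckeE` of ★ `Sec1Defs` (`ofOmega`, `bc1 ξ = ξ_E`).
[cite: GelbartRogawski1991, Lemma 6.2.2 (p. 469 L26–27)] -/
def XiRel {H : T.UGrp} (d : T.ThetaDatum H) (ξ : X.Char1) : Prop :=
  (D.ofOmega X.mu)⁻¹ * (D.ofOmega (S.gamma2 d))⁻¹ = D.bc1 ξ

/-- **P — LEMMA 6.2.2**: «Let `σ` be a cuspidal representation of `U(Φ′)`, where `Φ′` is a Hermitian form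
in two variables. Then there exists a cuspidal representation `ϱ` such that for almost all `v`, the Howe
lift of `σ_v` belongs to `Π(ϱ_v)`. More precisely, in the proof below, we define Hecke characters `γ₂` of
`E*` and `γ₃` of `E¹`, where the restriction of `γ₂` to `F*` is `ω_{E/F}`. Let `ξ` be the character of
`E¹` defined by the relation `μ⁻¹γ₂⁻¹(α) = ξ(α/ᾱ)`. Let `σ′` be the cuspidal L-packet on `U(2)`
corresponding to `σ` by the Jacquet- Langlands correspondence for two variable unitary groups. Then
`ϱ = ϱ₂ × ϱ₁` where `ϱ₂ = σ′ ⊗ (ξγ₃ ∘ det)` and `ϱ₁ = γ₃`.»  Typed, for the Howe lifts relative to the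
theta data `d = (s, ψ)` to which `γ₂ = gamma2 d`, `γ₃ = gamma3 d` are attached: the first sentence (some
cuspidal `ϱ = ϱ₂ × ϱ₁`, `D.IsCuspidalU2 ϱ₂`, receives the Howe lifts of `σ_v` for almost all `v`) AND the
«More precisely» clause for every `ξ` satisfying the printed relation (`XiRel`; the print presupposes
that `ξ` exists and is unique): `ϱ₂ = σ′ ⊗ (ξγ₃ ∘ det)` (`D.twistDetU2`) is a cuspidal L-packet on `U(2)`
and receives the Howe lifts, with `ϱ₁ = γ₃`.  Printed proof: the unramified computation pp. 469–471
(`UnramifiedHoweLiftData.howeLift_unramified`, `transfer_unramified`, `SplitHoweLiftData.howeLift_split`).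
[cite: GelbartRogawski1991, Lemma 6.2.2 (p. 469 L22–29)] -/
def lemma622 : Prop :=
  ∀ (H : T.UGrp), T.dim H = 2 → ∀ (σ : T.CuspRep H) (d : T.ThetaDatum H),
    (∃ (ϱ₂ : D.PacketU2) (ϱ₁ : X.Char1), D.IsCuspidalU2 ϱ₂ ∧ S.HoweLiftsInto σ d ϱ₂ ϱ₁) ∧
      ∀ ξ : X.Char1, S.XiRel d ξ →
        D.IsCuspidalU2 (D.twistDetU2 (S.jacquetLanglands σ) (ξ * S.gamma3 d)) ∧
          S.HoweLiftsInto σ d (D.twistDetU2 (S.jacquetLanglands σ) (ξ * S.gamma3 d)) (S.gamma3 d)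

end Sec6Data

/-! ## §4 The local computations of pp. 470–471 (one place `v` of `F`) -/

/-- **Posited LOCAL primitives at a place `v` of `F` that remains prime in `E`** for the unramified
Howe-lift computation of pp. 469–471 (`E_v/F_v` the quadratic extension of local fields, `U(2)` and
`G = U(3)` the local quasi-split unitary groups, `H = U(2) × U(1)`).  The characters of `E_v*` and of
`E_v¹` are the type PARAMETERS `CharE`, `Char1` with their Mathlib group structures (products `νγ₂`,
`νγ₂⁻¹`, `ξγ₃` as printed).  Fields, with the printed meaning:
* `LocRep2`, `LocRep3` — irreducible admissible representations of `U(2)(F_v)` and of `G_v`;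
* `IsUnramifiedE ν`, `IsUnramified1 κ` — unramified characters («Assume that `ν`, `γ₂`, and `γ₃` are
  unramified», p. 470 L25–26); `RestrictsToOmega γ₂` — «the restriction of `γ₂` to `F*` is `ω_{E/F}`»
  (p. 469 L26; p. 470 L14–15);
* `mu` — the local component `μ_v` of `μ` (the L-map `ᴸH → ᴸG` «defined by `μ`», p. 471 L2);
* `bc κ` — `κ_E`, `κ_E(α) = κ(α/ᾱ)` (§1.2 p. 450 «locally or globally»), a homomorphism;
* `ResidueCharNeTwo` — «the residual characteristic of `v` is different from 2» (p. 470 L26–27);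
* `piU2 λ` — «`π_{U(2)}(λ)`», the unramified constituent of `Ind_{U(2)}(λ)`, «induced from the lower
  triangular Borel subgroup of `U(2)`» from the character `diag(α, ᾱ⁻¹) ↦ λ(α)` (p. 470 L21–22, L27–28);
* `piG λ κ` — «`π_G(χ′)`», the unramified constituent of the principal series of `G` «induced from the
  upper triangular Borel subgroup of `G`» from `χ′(diag(α, β, ᾱ⁻¹)) = λ(α)κ(β)` (p. 470 L22–23, L27–28;
  p. 471 L2–3); so `π_G(λ) = piG λ 1`;
* `twistDet3 π κ` — `π ⊗ (κ ∘ det)` («`π_G(νγ₂⁻¹) ⊗ γ₃ ∘ det`», p. 470 L39);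
* `IsHoweLift γ₂ γ₃ π₂ π₃` — «`π₃` is the Howe lift of `π₂`» for the oscillator representation `ω(h, g)`
  of `U(2) × U(3)` on `𝒮(w₋₁ ⊗ V)` attached to an embedding `s` of `U(2) × U(3)` in `Mp(W ⊗ V)` whose
  characters in (p. 470 L16–17) are `(γ₂, γ₃)` (p. 470 L4–9, L18–19) and to `ψ_v`;
* `IsTransfer π₂ χ π₃` — «the endoscopic transfer of the representation `π₂ ⊗ χ` of `H = U(2) × U(1)`
  relative to the L-map `ᴸH → ᴸG` defined by `μ` is `π₃`» (p. 471 L1–2; unramified functoriality).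
[cite: GelbartRogawski1991, proof of Lemma 6.2.2, pp. 469–471] -/
structure UnramifiedHoweLiftData (CharE : Type u) (Char1 : Type u) [CommGroup CharE]
    [CommGroup Char1] : Type (u + 1) where
  /-- irreducible admissible representations of `U(2)(F_v)` [p. 470 L27] -/
  LocRep2 : Type u
  /-- irreducible admissible representations of `G_v = U(3)(F_v)` [p. 470 L27] -/
  LocRep3 : Type u
  /-- unramified characters of `E_v*` [p. 470 L25] -/
  IsUnramifiedE : CharE → Prop
  /-- unramified characters of `E_v¹` [p. 470 L25] -/
  IsUnramified1 : Char1 → Prop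
  /-- `γ₂|_{F_v*} = ω_{E_v/F_v}` [p. 469 L26; p. 470 L14–15] -/
  RestrictsToOmega : CharE → Prop
  /-- `μ_v` [§1.4 p. 450; p. 471 L2] -/
  mu : CharE
  /-- `κ ↦ κ_E`, `κ_E(α) = κ(α/ᾱ)` [§1.2 p. 450] -/
  bc : Char1 →* CharE
  /-- the residual characteristic of `v` is not `2` [p. 470 L26–27] -/
  ResidueCharNeTwo : Prop
  /-- `π_{U(2)}(λ)`, unramified constituent of `Ind_{U(2)}(λ)` (lower triangular Borel) [p. 470 L21–22, L27] -/
  piU2 : CharE → LocRep2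
  /-- `π_G(χ′)`, `χ′(diag(α, β, ᾱ⁻¹)) = λ(α)κ(β)`, unramified constituent (upper triangular Borel) [p. 470 L22–23; p. 471 L2–3] -/
  piG : CharE → Char1 → LocRep3
  /-- `π ⊗ (κ ∘ det)` [p. 470 L39] -/
  twistDet3 : LocRep3 → Char1 → LocRep3
  /-- «`π₃` is the Howe lift of `π₂`» for the data `s ↔ (γ₂, γ₃)` and `ψ_v` [p. 470 L4–9, L16–19] -/
  IsHoweLift : CharE → Char1 → LocRep2 → LocRep3 → Prop
  /-- «the endoscopic transfer of `π₂ ⊗ χ` … relative to the L-map defined by `μ` is `π₃`» [p. 471 L1–2] -/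
  IsTransfer : LocRep2 → Char1 → LocRep3 → Prop

namespace UnramifiedHoweLiftData

variable {CharE : Type u} {Char1 : Type u} [CommGroup CharE] [CommGroup Char1]
  (Y : UnramifiedHoweLiftData.{u} CharE Char1)

/-- «`π_G(ν ⊗ γ₃ ∘ det)`», the unramified constituent of `Ind_G(ν ⊗ γ₃ ∘ det)`: by the printed identity
`(γ₃ ∘ det)(diag(α, β, ᾱ⁻¹)) = γ₃((α/ᾱ)β)` (p. 470 L17) the inducing character is
`χ′(diag(α, β, ᾱ⁻¹)) = ν(α)γ₃(α/ᾱ)γ₃(β) = (ν γ₃_E)(α) γ₃(β)`, i.e. `piG (ν * bc γ₃) γ₃`.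
[cite: GelbartRogawski1991, proof of Lemma 6.2.2 (p. 470 L17, L27–28)] -/
def piGdet (ν : CharE) (κ : Char1) : Y.LocRep3 :=
  Y.piG (ν * Y.bc κ) κ

/-- **P — LOCAL (the unramified Howe lift `U(2) → U(3)`)**: «Assume that `ν`, `γ₂`, and `γ₃` are
unramified, and that the residual characteristic of `v` is different from 2. (In this case, the Howe
correspondence is known (cf. [Wd₂]). Let `π_{U(2)}(νγ₂)` and `π_G(ν ⊗ γ₃ ∘ det)` denote the unramified
constituents of `Ind_{U(2)}(νγ₂)` and `Ind_G(ν ⊗ γ₃ ∘ det)`, respectively. … This shows that the Howe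
lift of `π_{U(2)}(νγ₂)` is `π_G(ν ⊗ γ₃ ∘ det)`, or equivalently, the Howe lift of `π_{U(2)}(ν)` is
`π_G(νγ₂⁻¹) ⊗ γ₃ ∘ det`.»  (`v` remains prime; `γ₂` «a Hecke character of `E*` whose restriction to `F*`
is `ω_{E/F}`», p. 470 L14–15; both printed forms typed.)
[cite: GelbartRogawski1991, proof of Lemma 6.2.2 (p. 470 L25–39)] -/
def howeLift_unramified : Prop :=
  Y.ResidueCharNeTwo → ∀ (ν γ₂ : CharE) (γ₃ : Char1),
    Y.IsUnramifiedE ν → Y.IsUnramifiedE γ₂ → Y.RestrictsToOmega γ₂ → Y.IsUnramified1 γ₃ →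
      Y.IsHoweLift γ₂ γ₃ (Y.piU2 (ν * γ₂)) (Y.piGdet ν γ₃) ∧
        Y.IsHoweLift γ₂ γ₃ (Y.piU2 ν) (Y.twistDet3 (Y.piG (ν * γ₂⁻¹) 1) γ₃)

/-- **P — LOCAL (the unramified endoscopic transfer `H → G`)**: «the endoscopic transfer of the
representation `π_{U(2)}(ν) ⊗ χ` of `H = U(2) × U(1)` relative to the L-map `ᴸH → ᴸG` defined by `μ` is
`π_G(χ′)`, where `χ′(diag(α, β, α)) = νμ(α)χ(β)` [sic: `diag(α, β, ᾱ⁻¹)`].»  READING: `ν`, `μ_v`, `χ`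
unramified (the context of the computation, p. 470 L25; `π_{U(2)}(ν)` and `π_G(χ′)` are unramified
constituents) — the conservative reading. [cite: GelbartRogawski1991, proof of Lemma 6.2.2 (p. 471 L1–3)] -/
def transfer_unramified : Prop :=
  ∀ (ν : CharE) (χ : Char1), Y.IsUnramifiedE ν → Y.IsUnramifiedE Y.mu → Y.IsUnramified1 χ →
    Y.IsTransfer (Y.piU2 ν) χ (Y.piG (ν * Y.mu) χ)

end UnramifiedHoweLiftData

/-- **Posited LOCAL primitives at a SPLIT place `v`** (p. 471 L7–17: «identify `H` and `G` with `GL₂(F_v)`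
and `GL₃(F_v)`, respectively, by choosing a place `w` of `E` above `v`»).  Fields: `GL2Rep` —
irreducible (admissible) representations `σ″` of `GL₂(F_v)`; `GL3Rep` — admissible representations of
`GL₃(F_v)`; `contragredient σ″ = σ*` («Here `σ*` is the contragredient of `σ″`», p. 471 L16);
`indLowerP σ` — «the representation `π` induced from `σ ⊗ 1` on the lower (2,1)-parabolic subgroup `P`
of `GL₃`» (p. 471 L14–15); `IsHoweLift σ″ π` — `π` is the Howe lift of `σ″` for «the oscillator
representation of `GL₂ × GL₃` on `𝒮(M_{2×3}(F))` defined by `ω(h, g)ϕ(X) = |det(h)|^{3/2} |det(g)| ϕ(ᵗhXg)`»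
(p. 471 L10–11). [cite: GelbartRogawski1991, proof of Lemma 6.2.2 (p. 471 L7–17)] -/
structure SplitHoweLiftData : Type (u + 1) where
  /-- irreducible representations `σ″` of `GL₂(F_v)` [p. 471 L11–12] -/
  GL2Rep : Type u
  /-- admissible representations of `GL₃(F_v)` [p. 471 L14–15] -/
  GL3Rep : Type u
  /-- `σ″ ↦ σ*`, the contragredient [p. 471 L16] -/
  contragredient : GL2Rep → GL2Rep
  /-- `σ ↦ Ind_P(σ ⊗ 1)`, `P` the lower `(2,1)`-parabolic of `GL₃` [p. 471 L14–15] -/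
  indLowerP : GL2Rep → GL3Rep
  /-- «`π` is the Howe lift of `σ″`» for `ω(h, g)ϕ(X) = |det h|^{3/2} |det g| ϕ(ᵗhXg)` on `𝒮(M_{2×3}(F_v))` [p. 471 L10–11, L17] -/
  IsHoweLift : GL2Rep → GL3Rep → Prop

/-- **P — LOCAL, split place (citing [MVW])**: «for all `ϕ, v`, `F(g, ϕ, v)` belongs to the space of the
representation `π` induced from `σ* ⊗ 1` on the lower (2,1)-parabolic subgroup `P` of `GL₃`. Here `σ*` is
the contragredient of `σ″`. It follows that `Ind_p(σ ⊗ 1)` [sic: read `Ind_P(σ* ⊗ 1)`, the representation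
of the preceding sentence] is the Howe lift of `σ″` (cf. [MVW]).»
[cite: GelbartRogawski1991, proof of Lemma 6.2.2 (p. 471 L13–17)] -/
def SplitHoweLiftData.howeLift_split (Z : SplitHoweLiftData.{u}) : Prop :=
  ∀ σ : Z.GL2Rep, Z.IsHoweLift σ (Z.indLowerP (Z.contragredient σ))

end Literature.NumberTheory.GelbartRogawski1991.Sec6

end
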